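import Mathlib
import Summits.Ventures.PercRepro.TriangleCapFourBelowElevenC
import Summits.Ventures.PercRepro.TriangleCapFourBelowElevenD
import Summits.Ventures.PercRepro.TriangleCapFourBelowTwelveE

/-!
# PercRepro — THE CELL `(11, 20)`: FOUR BELOW THE DIAGONAL IS EXACT ON THE `K₄⁻`-FREE CLASS FOR EVERY `k ≥ 11`
(p3, gen 39; part 146)

`four_below_diagonal_exact_k4m_of_eleven_modulo` (the cell theorem on the `k ≥ 11` assembly of part 144), the
residue of part 145 through the largest private set, and **`four_below_diagonal_exact_k4m_all''`**: for every
`k ≥ 11`, `3 ≤ a`, `2a + 4 ≤ k` the maximum of `2·Σ_v C(d(v), 2)` over the `K₄⁻`-free graphs on `Fin k` with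
`a (k − a) − 4` edges is `(a (k − a) − 4)(k − 2) − 4 (k − 5)` — the cell `(11, 20) 78` joins the sub-diagonal
`r = 4`.  Axioms: standard.
-/

namespace PercRepro

namespace TriangleCap

namespace C047

open Finset

variable {V : Type*} [Fintype V] [DecidableEq V]

/-- **FOUR BELOW THE DIAGONAL ON THE `K₄⁻`-FREE CLASS FOR `k ≥ 11`, MODULO THE ONE-TRIANGLE RESIDUE:** for `1 ≤ a`,
`a + 4 ≤ k`, `m = a (k − a) − 4 ≥ 2k − 4` with `m, m + 1, m + 2, m + 3` not of the form `a′ (k − a′)`, the maximum of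
`2·Σ_v C(d(v), 2)` over the `K₄⁻`-free graphs on `Fin k` with `m` edges is `m (k − 2) − 4 (k − 5)`, attained by
`K_{a, k−a}` minus four edges at one vertex — given the one-triangle residue `hone` for the graphs of the cell. -/
theorem four_below_diagonal_exact_k4m_of_eleven_modulo (k a : ℕ) (hk : 11 ≤ k) (ha : 1 ≤ a) (hak : a + 4 ≤ k)
    (hdense : 2 * k ≤ a * (k - a) - 4 + 4)
    (hm : ∀ a', a' ≤ k → a * (k - a) - 4 ≠ a' * (k - a') ∧ a * (k - a) - 3 ≠ a' * (k - a') ∧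
      a * (k - a) - 2 ≠ a' * (k - a') ∧ a * (k - a) - 1 ≠ a' * (k - a'))
    (hone : ∀ (D : SimpleGraph (Fin k)) [DecidableRel D.Adj], K4mFree D → D.edgeFinset.card = a * (k - a) - 4 →
      ∀ u v w, D.Adj u v → D.Adj u w → D.Adj v w →
      (∀ a b c, D.Adj a b → D.Adj a c → D.Adj b c → a = u ∨ a = v ∨ a = w) → (∀ z, 2 ≤ deg D z) →
      10 * ((({u, v, w} : Finset (Fin k))ᶜ).filter (fun z => degIn D {u, v, w} z = 0)).card +
        2 * D.edgeFinset.card + 28 < 8 * k →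
      (((({u, v, w} : Finset (Fin k))ᶜ).filter (fun z => degIn D {u, v, w} z = 0)).card ≤ 4 ∨
        3 * k ≤ D.edgeFinset.card) →
      ∑ v, deg D v * deg D v + 4 * (k - 5) ≤ D.edgeFinset.card * k) :
    (∀ (D : SimpleGraph (Fin k)) [DecidableRel D.Adj], K4mFree D →
        D.edgeFinset.card = a * (k - a) - 4 →
        2 * cherries D + 4 * (k - 5) ≤ (a * (k - a) - 4) * (k - 2)) ∧
      ∃ (D : SimpleGraph (Fin k)) (_ : DecidableRel D.Adj), K4mFree D ∧
        D.edgeFinset.card = a * (k - a) - 4 ∧ 2 * cherries D + 4 * (k - 5) = (a * (k - a) - 4) * (k - 2) := by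
  have hka : 4 ≤ a * (k - a) := by
    obtain ⟨c, hc⟩ : ∃ c, k = a + 4 + c := ⟨k - a - 4, by omega⟩
    subst hc
    have : a + 4 + c - a = 4 + c := by omega
    rw [this]
    nlinarith
  have hcell := cell_arith_four k a (by omega) (by omega) (by omega)
  obtain ⟨m, hmm⟩ : ∃ m, a * (k - a) = m + 4 := ⟨a * (k - a) - 4, by omega⟩
  have e1 : a * (k - a) - 4 = m := by omega
  have e2 : a * (k - a) - 3 = m + 1 := by omega
  have e3 : a * (k - a) - 2 = m + 2 := by omega
  have e4 : a * (k - a) - 1 = m + 3 := by omega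
  rw [e1] at hdense hm hone ⊢
  rw [e2, e3, e4] at hm
  rw [hmm] at hcell
  constructor
  · intro D _ hK hD
    have hcard : Fintype.card (Fin k) = k := Fintype.card_fin k
    have hprod : ∀ a', a' ≤ Fintype.card (Fin k) → D.edgeFinset.card ≠ a' * (Fintype.card (Fin k) - a') ∧
        D.edgeFinset.card + 1 ≠ a' * (Fintype.card (Fin k) - a') ∧
        D.edgeFinset.card + 2 ≠ a' * (Fintype.card (Fin k) - a') ∧
        D.edgeFinset.card + 3 ≠ a' * (Fintype.card (Fin k) - a') := by
      intro a' ha'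
      rw [hcard] at ha' ⊢
      rw [hD]
      exact hm a' ha'
    have h1 := dense_stability_four_modulo_few_outer_eleven D hK (by rw [hcard]; exact hk) (by rw [hcard, hD]; omega)
      hprod (by
        intro u v w huv huw hvw hT hdeg hq hor
        rw [hcard] at hq hor ⊢
        exact hone D hK hD u v w huv huw hvw hT hdeg hq hor)
    have h2 := two_mul_cherries_add D
    have h3 := sum_deg_eq D
    rw [hcard, hD] at h1
    rw [hD] at h3
    obtain ⟨k', hk'⟩ : ∃ k', k = k' + 5 := ⟨k - 5, by omega⟩
    subst hk'
    have e5 : k' + 5 - 5 = k' := by omega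
    have e6 : k' + 5 - 2 = k' + 3 := by omega
    rw [e5] at h1 ⊢
    rw [e6]
    nlinarith
  · refine ⟨bipMinusStar k a 4, inferInstance, k4mFree_bipMinusStar k a 4, ?_, ?_⟩
    · have := card_edges_bipMinusStar k a 4 ha hak
      omega
    · have h := two_mul_cherries_bipMinusStar k a 4 ha hak (by omega)
      rw [hmm] at h
      obtain ⟨k', hk'⟩ : ∃ k', k = k' + 5 := ⟨k - 5, by omega⟩
      subst hk'
      have e5 : k' + 5 - 5 = k' := by omega
      have e6 : k' + 5 - 2 = k' + 3 := by omega
      have e7 : 2 * (k' + 5) - 4 - 3 = 2 * k' + 3 := by omega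
      rw [e6, e7] at h
      rw [e5, e6]
      nlinarith



/-- **THE CELL `(11, 20)`:** the maximum of `2·Σ_v C(d(v), 2)` over the `K₄⁻`-free graphs on `Fin 11` with `20`
edges is `20 · 9 − 24 = 156`, attained by `K_{3, 8}` minus four edges at one vertex. -/
theorem four_below_diagonal_exact_k4m_eleven_twenty :
    (∀ (D : SimpleGraph (Fin 11)) [DecidableRel D.Adj], K4mFree D → D.edgeFinset.card = 20 →
        2 * cherries D + 24 ≤ 180) ∧
      ∃ (D : SimpleGraph (Fin 11)) (_ : DecidableRel D.Adj), K4mFree D ∧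
        D.edgeFinset.card = 20 ∧ 2 * cherries D + 24 = 180 := by
  have h := four_below_diagonal_exact_k4m_of_eleven_modulo 11 3 (by norm_num) (by norm_num) (by norm_num)
    (by norm_num) (products_avoid 11 3 (by norm_num) (by norm_num)) (by
      intro D _ hK hD u v w huv huw hvw hT hdeg hpay hor
      have hcard : Fintype.card (Fin 11) = 11 := Fintype.card_fin 11
      have := residue_of_largest D 4
        (fun u v w huv huw hvw hT hmv hmw hq =>
          one_triangle_residue_three_eleven D hK huv huw hvw hT (by rw [hcard]) hdeg hmv hmw
            (by rw [hcard, hD]) hq)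
        huv huw hvw hT (by rw [hD] at hor; omega)
      rwa [hcard] at this)
  norm_num at h
  exact h

/-- **FOUR BELOW THE DIAGONAL IS EXACT ON THE `K₄⁻`-FREE CLASS ON EVERY CELL `k ≥ 11`, `3 ≤ a`, `2a + 4 ≤ k`.** -/
theorem four_below_diagonal_exact_k4m_all'' (k a : ℕ) (hk : 11 ≤ k) (ha : 3 ≤ a) (hak : 2 * a + 4 ≤ k) :
    (∀ (D : SimpleGraph (Fin k)) [DecidableRel D.Adj], K4mFree D →
        D.edgeFinset.card = a * (k - a) - 4 →
        2 * cherries D + 4 * (k - 5) ≤ (a * (k - a) - 4) * (k - 2)) ∧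
      ∃ (D : SimpleGraph (Fin k)) (_ : DecidableRel D.Adj), K4mFree D ∧
        D.edgeFinset.card = a * (k - a) - 4 ∧ 2 * cherries D + 4 * (k - 5) = (a * (k - a) - 4) * (k - 2) := by
  rcases Nat.lt_or_ge k 12 with h11 | h12
  · have hk11 : k = 11 := by omega
    subst hk11
    have ha3 : a = 3 := by omega
    subst ha3
    have h := four_below_diagonal_exact_k4m_eleven_twenty
    norm_num
    exact h
  · exact four_below_diagonal_exact_k4m_all' k a h12 ha hak

end C047

end TriangleCap

end PercRepro
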